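import Summits.AtomisticToContinuum.Crystallization.Theorems.OverbindingBudgetElasticSplitPeriodic
import Summits.AtomisticToContinuum.Crystallization.Theorems.ChartedPlanarOrderDoorLayered

/-!
# OverbindingBudget × ChartedPlanarOrder — convergence #3 as an IMPLICATION: the RDEF Liouville leaf from N's `DoorPeriodic Λ`
# (lens-4 g28; critic row 410 (2), second half)

Helper file (`--supports stmt-AtomisticToContinuum-31280`).  `…ElasticSplitPeriodic` cut the Liouville leaf of the RDEF cone at exact
two-periodicity: `ShearFreeLiouvilleLaw ⟸ L_opt ∧ E_per` with L_opt `OptimalTexturePeriodic Λ T₀ D` = «unstrained locally optimal texture of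
the uncompressed recurrent clean class with sparse charge ⟹ `TwoPeriodic Λ`».  N's column (lens-3 g22, tree `ChartedPlanarOrderDoorLayered`)
carries L1′♮ `DoorPeriodic Λ := ∀ δ > 0, ∀ S, IsDoorSet δ S → TwoPeriodic Λ S` (door set = rooted, separated, (1/16, 9/10, 1)-two-shell clean,
single-site Nash, Barlow-bond-charted).  This file proves the convergence edge

  `optimalTexturePeriodic_of_doorPeriodic : CleanTwoShell T₀ D → CleanCharted T₀ D → DoorPeriodic Λ → OptimalTexturePeriodic Λ T₀ D`

modulo the two BRIDGE pieces that turn an L_opt texture into a door set — rooting (`0 ∈ Y`), separation (`UniformlyDiscrete = ∃ δ, IsSep δ`,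
`rfl`) and Nash stationarity (`isNash_of_locallyOptimal`, the Liouville dictionary) are PROVED; what is NOT is the geometry of the environments:
* **B₁ `CleanTwoShell T₀ D`**: every atom of such a texture is (1/16, 9/10, 1)-TWO-SHELL-GOOD (its 18-atom environment within `3a/2` is
  `a/16`-close to the fcc or hcp two-shell pattern).  `RT a T₀`-cleanness controls first-shell DISTANCES only (twelve atoms in
  `[a(1−1/50)−T₀, a(1+1/50)+T₀]`, gap to `a·63/50 − T₀`), neither the first-shell SHAPE (an icosahedral shell passes RT) nor the second shell
  (free beyond the gap) — so B₁ is a genuine piece (local optimality + zero excess should exclude non-Barlow shells; UNDECIDED·TRUE-type);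
* **B₂ `CleanCharted T₀ D`**: such a texture, two-shell-good everywhere, is Barlow-bond-CHARTED (`IsCharted (μS Y)`: a bijective developing map
  from a Barlow stacking) — the critic's «ONE lemma» (developing map / monodromy on a simply connected domain; ATTACKABLE·M, census-free).
With them the RDEF cone takes N's Liouville statement as its Liouville hypothesis:
`rdef_of_grossU_doorPeriodic : GrossCleanBallsU (1/250) 10 → ChargedEnergyGap → CompressedVirialLaw (1/250) 10 → CleanTwoShell (1/250) 10 →
CleanCharted (1/250) 10 → DoorPeriodic Λ → PeriodicStrainedCubes Λ (1/250) 10 → CleanlessExcessT → CoherentResidual 10 → RobustDefectLimitWindows`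
— ONE Liouville crux (`DoorPeriodic`) for both columns.
-/

namespace Summit.AtomisticToContinuum.Crystallization.Theorems.OverbindingBudgetElasticSplitDoorBridge

open MeasureTheory
open Literature.MathematicalPhysics.StatisticalMechanics (UniformlyDiscrete)
open Literature.Geometry.DiscreteGeometry (IsTwoShellGoodSet)
open Summit.AtomisticToContinuum.Crystallization.Theses.OverbindingBudget (RobustDefectLimitWindows)
open Summit.AtomisticToContinuum.Crystallization.Theses.PricedLinkCensus (ChargedEnergyGap)
open Summit.AtomisticToContinuum.Crystallization.Theorems.OverbindingBudgetGradedBareness (CleanlessExcessT)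
open Summit.AtomisticToContinuum.Crystallization.Theorems.OverbindingBudgetCoherentCut (CoherentResidual)
open Summit.AtomisticToContinuum.Crystallization.Theorems.OverbindingBudgetUniformCutStatements (GrossCleanBallsU)
open Summit.AtomisticToContinuum.Crystallization.Theorems.OverbindingBudgetEdgeRelaxationStatements (CleanClass)
open Summit.AtomisticToContinuum.Crystallization.Theorems.OverbindingBudgetElasticSplitStatements (SparseCharge LocallyOptimal)
open Summit.AtomisticToContinuum.Crystallization.Theorems.OverbindingBudgetElasticSplitScale (HasCompressedScale CompressedVirialLaw)
open Summit.AtomisticToContinuum.Crystallization.Theorems.OverbindingBudgetElasticSplitPeriodic (Unstrained OptimalTexturePeriodic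
  PeriodicStrainedCubes rdef_of_grossU_periodicSplit)
open Summit.AtomisticToContinuum.Crystallization.Theorems.OverbindingBudgetLiouvilleDictionary (isNash_of_locallyOptimal)
open Summit.AtomisticToContinuum.Crystallization.Theorems.ChartedPlanarOrderRigidityDoor (IsClean IsNash IsCharted)
open Summit.AtomisticToContinuum.Crystallization.Theorems.ChartedPlanarOrderDensityDichotomy (μS IsSep)
open Summit.AtomisticToContinuum.Crystallization.Theorems.ChartedPlanarOrderMesoCut (IsDoorSet)
open Summit.AtomisticToContinuum.Crystallization.Theorems.ChartedPlanarOrderDoorLayered (TwoPeriodic DoorPeriodic)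

/-! ## §1 The atom set of the counting measure; two-shell cleanliness intrinsically -/

/-- The atoms of the counting measure `μS Y` are the points of `Y`. [folklore] -/
theorem setOf_μS_singleton_ne_zero (Y : Set (EuclideanSpace ℝ (Fin 3))) : {p : EuclideanSpace ℝ (Fin 3) | μS Y {p} ≠ 0} = Y := by
  ext p
  exact Literature.Probability.Process.count_restrict_singleton_ne_zero_iff Y p

/-- N's binder `IsClean (μS Y)` read intrinsically: every point of `Y` is (1/16, 9/10, 1)-two-shell-good in `Y`. [this file] -/
theorem isClean_μS_iff (Y : Set (EuclideanSpace ℝ (Fin 3))) :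
    IsClean (μS Y) ↔ ∀ q ∈ Y, IsTwoShellGoodSet (1 / 16) (9 / 10) 1 Y q := by
  unfold IsClean
  rw [setOf_μS_singleton_ne_zero]
  constructor
  · intro h q hq
    exact h q ((Literature.Probability.Process.count_restrict_singleton_ne_zero_iff Y q).2 hq)
  · intro h q hq
    exact h q ((Literature.Probability.Process.count_restrict_singleton_ne_zero_iff Y q).1 hq)

/-! ## §2 The two bridge pieces -/

/-- **B₁ · `CleanTwoShell T₀ D`**: every atom of an unstrained, locally optimal texture of the uncompressed recurrent clean class with sparse
charge is (1/16, 9/10, 1)-two-shell-good.  (`RT`-cleanness fixes first-shell distances, not the shell's shape nor the second shell.)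
UNDECIDED·TRUE-type. [piece] -/
def CleanTwoShell (T₀ D : ℝ) : Prop :=
  ∀ Y : Set (EuclideanSpace ℝ (Fin 3)), CleanClass T₀ D Y → ¬ HasCompressedScale T₀ Y → SparseCharge Y → LocallyOptimal Y → Unstrained Y →
    ∀ q ∈ Y, IsTwoShellGoodSet (1 / 16) (9 / 10) 1 Y q

/-- **B₂ · `CleanCharted T₀ D`** (the critic's «ONE lemma», row 410 (2)): such a texture, two-shell-good at every atom, is Barlow-bond-charted.
ATTACKABLE·M (developing map of the local Barlow charts, monodromy-free on `ℝ³`). [piece] -/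
def CleanCharted (T₀ D : ℝ) : Prop :=
  ∀ Y : Set (EuclideanSpace ℝ (Fin 3)), CleanClass T₀ D Y → ¬ HasCompressedScale T₀ Y → SparseCharge Y → LocallyOptimal Y → Unstrained Y →
    (∀ q ∈ Y, IsTwoShellGoodSet (1 / 16) (9 / 10) 1 Y q) → IsCharted (μS Y)

/-! ## §3 L_opt textures are door sets; the convergence edge; the cone -/

/-- A rooted, uniformly discrete, locally optimal texture that is two-shell-good everywhere and charted is a DOOR SET at its separation. [this file] -/
theorem isDoorSet_of_locallyOptimal {Y : Set (EuclideanSpace ℝ (Fin 3))} (hUD : UniformlyDiscrete Y) (h0 : (0 : EuclideanSpace ℝ (Fin 3)) ∈ Y)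
    (hlo : LocallyOptimal Y) (h2 : ∀ q ∈ Y, IsTwoShellGoodSet (1 / 16) (9 / 10) 1 Y q) (hch : IsCharted (μS Y)) :
    ∃ δ : ℝ, 0 < δ ∧ IsDoorSet δ Y := by
  obtain ⟨δ, hδ, hsep⟩ := hUD
  exact ⟨δ, hδ, h0, hsep, (isClean_μS_iff Y).2 h2, isNash_of_locallyOptimal hlo, hch⟩

/-- **THE CONVERGENCE EDGE.** `B₁ → B₂ → DoorPeriodic Λ → OptimalTexturePeriodic Λ T₀ D`: N's exact Liouville statement for door sets delivers
the Liouville piece of the RDEF column. [this file] -/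
theorem optimalTexturePeriodic_of_doorPeriodic {Λ T₀ D : ℝ} (h₁ : CleanTwoShell T₀ D) (h₂ : CleanCharted T₀ D) (h : DoorPeriodic Λ) :
    OptimalTexturePeriodic Λ T₀ D := by
  intro Y hY hnc hsc hlo hu
  have h2 := h₁ Y hY hnc hsc hlo hu
  obtain ⟨δ, hδ, hdoor⟩ := isDoorSet_of_locallyOptimal hY.1 hY.2.1 hlo h2 (h₂ Y hY hnc hsc hlo hu h2)
  exact h δ hδ Y hdoor

/-- **RDEF cone with N's Liouville statement as the Liouville hypothesis** (every `Λ`): `GrossCleanBallsU (1/250) 10 → ChargedEnergyGap →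
CompressedVirialLaw (1/250) 10 → CleanTwoShell (1/250) 10 → CleanCharted (1/250) 10 → DoorPeriodic Λ → PeriodicStrainedCubes Λ (1/250) 10 →
CleanlessExcessT → CoherentResidual 10 → RobustDefectLimitWindows`. [this file] -/
theorem rdef_of_grossU_doorPeriodic (Λ : ℝ) (hG : GrossCleanBallsU (1 / 250) 10) (hCEG : ChargedEnergyGap)
    (hC : CompressedVirialLaw (1 / 250) 10) (h₁ : CleanTwoShell (1 / 250) 10) (h₂ : CleanCharted (1 / 250) 10) (hD : DoorPeriodic Λ)
    (hE : PeriodicStrainedCubes Λ (1 / 250) 10) (hCE : CleanlessExcessT) (hR : CoherentResidual 10) : RobustDefectLimitWindows :=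
  rdef_of_grossU_periodicSplit Λ hG hCEG hC (optimalTexturePeriodic_of_doorPeriodic h₁ h₂ hD) hE hCE hR

end Summit.AtomisticToContinuum.Crystallization.Theorems.OverbindingBudgetElasticSplitDoorBridge
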